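import Literature.MathematicalPhysics.QuantumFieldTheory.Balaban1983to89.B1TorusCubeBoxOp

/-!
# `Balaban1983to89.B1TorusCubeLpInput` — [Balaban1983RegularityDecay] Lemma 2.2 (2.17) AND THE GRADED FACTORS OF (2.21) p. 578
# «‖K_{ω₁}G_k(□_{ω₁},Ã_{ω₁})h_{ω₁}‖_{∞,p₁} Π_i ‖K_{ω_i}G_k(□_{ω_i},Ã_{ω_i})h_{ω_i}‖_{p₁/(i−1),p₁/i} … ‖·‖_{2,2}» ON THE CUBES `□_j` OF THE
# (Higgs)₂,₃ TORUS `T_ε` OF [Balaban1982Higgs1] AT `Ã_j`, in the `η`-weighted `L^p` norms of the torus — the per-cube inputs `hgr`, `h2`,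
# `h0`, `ha` of the mixed `L^p` chain (2.18)–(2.22) (`B4Ineq110LpChain`) for REGIONS, transported along gen 8's cube chart from this
# seat's box theorems `B4Eq220FactorField.eq221_pq_box` / `eq221_psup_box`

statement-level skeleton of published theorems with citation tags; proofs where landed; nothing here is a claim about the Yang–Mills mass gap

PDF held: `paper:balaban1983-cmp89-regularity-decay` pp. 577–579 [PDF 7–9] (text layer re-read by this seat);
`paper:balaban1982-cmp85-higgs23-i` p. 610 [PDF 8].

CITATION HEADER (lean-in-tree rule).  T. Bałaban, *Regularity and decay of lattice Green's functions*, Commun. Math. Phys. **89**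
(1983) 571–597 [Balaban1983RegularityDecay] (Lemma 2.2 (2.17) p. 578, (2.20)–(2.21) p. 578) and T. Bałaban, *(Higgs)₂,₃ quantum fields in
a finite volume. I*, Commun. Math. Phys. **85** (1982) 603–626 [Balaban1982Higgs1] ((2.20) p. 610, Prop. 2.1 p. 610).  Cell `lit-balaban`
(HOME `run/shared/lean/pub/lit-balaban/`), Phase-2 proof seat **p35** gen 12 (unit `lit-balaban-p35`); SKELETON rows **B4.Lem2.2** / **B4.Eq2.18**
((2.17), (2.20), (2.21): MODEL INSTANCES on the cubes of the (Higgs)₂,₃ torus, graded norms), feeding **B1.Prop2.1** for regions on the concrete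
carrier.  USED BY NAME, never restated: gen 8's `B1TorusCubeBoxOp` (the chart dictionary `pull_propagatorK`, `pull_commutator`,
`pull_hsmul_hTor`, `norm_eq_supN_pull`, the box field `boxField`/`acT`, `cube_inputs`' frame), `B1TorusCubeChart.pull`, `B1TorusCubeContours.gammaT`,
this seat's gens 5–7 `B4Eq220FactorField.{eq220_sup_box, eq221_pq_box, eq221_psup_box}`, `B4Lemma22CrossSup.lemma22_17_sup_box`,
`B4CubeFieldHyps22.{cubeField_hyps, cubeField_threshold}`, r01's `B4Lemma22EtaBox.{vol, lpW}`, `B4Lemma22LpStair.{lpS, lpM}`.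

WHAT IS PRINTED.  pp. 577–578: *«Lemma 2.2. … and a constant c₂ depending on d, p₁, such that ‖G_k(□, Ã)f‖_q, ‖D^η_{Ã,μ}G_k(□, Ã)f‖_q,
‖G_k(□, Ã)D^{η*}_{Ã,μ}f‖_q ≤ c₂‖f‖_p (2.17) for 1 ≤ p, q ≤ ∞, satisfying the condition 1/p − 1/p₁ ≤ 1/q ≤ 1/p with p₁ > d.»* (the (2.17)
sentence re-read on the ×2 render `…-p008-x2.png`; docfix S-B1-g45-1 of ref-4 gen 45, filed gen 13 — the theorem's hypothesis `1/p − 1/q ≤ 1/p₁`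
IS this printed condition; no declaration changed); *«We apply Lemma 2.2 to the terms of the second sum also, more exactly
we apply (2.17) with 1/p₁ = 1/(2n₀) and we fix n₀ such that p₁ = 2n₀ > d + 1, e.g. n₀ = d. We estimate the second sum by
Σ′ c₁‖K_{ω₁}G_k(□_{ω₁},Ã_{ω₁})h_{ω₁}‖_{∞,p₁} Π_{i=2}^{n₀}‖K_{ω_i}G_k(□_{ω_i},Ã_{ω_i})h_{ω_i}‖_{p₁/(i−1),p₁/i} Π_{i=n₀+1}^{n}‖…‖_{2,2}‖f‖₂ ≤
Σ′ c₁(c₂O(1)M⁻¹)ⁿ‖f‖_∞. (2.21)»*; p. 579: *«Here ‖T‖_{q,p} denotes a norm of an operator T : L^p → L^q.»*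

WHAT THIS FILE PROVES (kernel-checked, zero `sorry`; one definition with body + theorems; no `Prop` fact).
* §1 `lpT K p ψ = (L^{−Kd} Σ_x ‖ψ(x)‖^p)^{1/p}` — the `η`-weighted mixed `L^p` norm of a field on `T_ε` (`η = L^{−K}`: each site of
  `T_ε` has `η`-volume `L^{−Kd}`; r01's `lpW` along the chart), `lpT_nonneg`; the CHART TRANSPORT `sum_box_eq_sum_cube`, `lpM_pull_le`
  (`‖pull ψ‖_p ≤ (Σ_x‖ψ(x)‖^p)^{1/p}`), `lpM_pull_eq` (equality for `□_j`-supported fields), `lpW_pull_le`, `lpW_pull_eq`.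
* §2 **`cube_inputs_lp`** — FOR EVERY CUBE `□_j` OF `T_ε` AT `Ã_j`, under exactly the hypotheses of gen 8's `cube_inputs` (window
  `a ∈ [amin, aplus]`, `m²(L^Kε)² ≤ m²₊`, `K₀ ≥ 8`, `1 ≤ K ≤ K_P`, `K₀ ∣ M_P`, `3M ≤ |T_ε|_μ`, the chart-form (1.7)/(2.23) regularity of
  `A` on `□_j` with `e_K ≤ e₁(K₀)` — the print's «for e sufficiently small») and an exponent `p₁ > d`: constants `C_γ, C_β > 0` (functions of `d, L, amin, aplus, m²₊, N, (e,q), p₁`)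
  with (2.17) `‖G_j(h_jψ)‖_∞ ≤ C_γ(L^Kε)²‖ψ‖_∞`, (2.20) `‖K_jG_j(h_jψ)‖_∞ ≤ (C_β/K₀)‖ψ‖_∞`, and THE GRADED FACTORS OF (2.21):
  `‖K_jG_j(h_jψ)‖_{q,η} ≤ (C_β/K₀)‖ψ‖_{p,η}` for all `1 ≤ p ≤ q` with `1/p − 1/q ≤ 1/p₁` (so «‖·‖_{p₁/(i−1),p₁/i}» and «‖·‖_{2,2}»), and
  `‖K_jG_j(h_jψ)‖_∞ ≤ (C_β/K₀)‖ψ‖_{p,η}` for `p ≥ p₁` («‖·‖_{∞,p₁}»), all with ONE threshold `e₁(K₀)`.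
HONEST SCOPE.  The cubes `□_j` with the gauged field `Ã_j` only (interior cubes of a region; the boundary pieces are
`B1Lemma21RegularRegion`); norms: sup = the sup of the Euclidean site norms, `‖·‖_{p,η}` = `lpT` (mixed: Euclidean over colours, `ℓ^p`
over sites, weight `L^{−Kd}` per site); constants existential (crude, through the Lemma-2.2 lineage); `m² > 0`; the chart-form regularity
hypothesis is gen 8's (`acT`), discharged from the printed (2.23) in the sequel as in gen 11's `B1Ineq225RegularTorus.abs_acT_sub_le_of_reg`.
Unit `lit-balaban-p35` gen 12 (literature-prover-lit-balaban-p35-g12-0).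
-/

open scoped BigOperators

noncomputable section

namespace Literature.MathematicalPhysics.QuantumFieldTheory.Balaban1983to89.B1TorusCubeLpInput

open Matrix
open Literature.MathematicalPhysics.QuantumFieldTheory.Balaban1983to89.HiggsLattice
open Literature.MathematicalPhysics.QuantumFieldTheory.Balaban1983to89.HiggsAveraging
open Literature.MathematicalPhysics.QuantumFieldTheory.Balaban1983to89.HiggsCovariance
open Literature.MathematicalPhysics.QuantumFieldTheory.Balaban1983to89.HiggsCovariancePos
  (shift_unshift unshift_shift isUnit_covOpK covOpK_mul_propagatorK covOpK_propagatorK_apply)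
open Literature.MathematicalPhysics.QuantumFieldTheory.Balaban1983to89.B1TorusCubeCover
open Literature.MathematicalPhysics.QuantumFieldTheory.Balaban1983to89.B1TorusCubeLocality26
open Literature.MathematicalPhysics.QuantumFieldTheory.Balaban1983to89.B1TorusCubeChart
open Literature.MathematicalPhysics.QuantumFieldTheory.Balaban1983to89.B1TorusCubeContours
open Literature.MathematicalPhysics.QuantumFieldTheory.Balaban1983to89.B1TorusCubeBoxOp
open Literature.MathematicalPhysics.QuantumFieldTheory.Balaban1983to89.B4GaugeCovariance
open Literature.MathematicalPhysics.QuantumFieldTheory.Balaban1983to89.B4Commutators25to211 (mulH fld_mulH_mulVec)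
open Literature.MathematicalPhysics.QuantumFieldTheory.Balaban1983to89.B4Reflection242 (boxDom mem_boxDom blk nbrs mem_nbrs
  nbrs_comm blk_mem_boxDom)
open Literature.MathematicalPhysics.QuantumFieldTheory.Balaban1983to89.B4Lower18Regular (e1 e1_apply_self e1_apply_ne
  lsum PathRel baseEmb abs_lsum_le blkWt_ne_zero)
open Literature.MathematicalPhysics.QuantumFieldTheory.Balaban1983to89.B4Lemma21Region (siteNorm)
open Literature.MathematicalPhysics.QuantumFieldTheory.Balaban1983to89.B4Lemma22Reduce231 (supN le_supN supN_le supN_nonneg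
  siteNorm_nonneg)
open Literature.MathematicalPhysics.QuantumFieldTheory.Balaban1983to89.B4Lemma22PertVSup (contourTrans_fieldLink
  fld_avgOp_transpose_mulVec supN_neg supN_smul_le)
open Literature.MathematicalPhysics.QuantumFieldTheory.Balaban1983to89.B4Lemma22ReduceZero (Box opA greenA)
open Literature.MathematicalPhysics.QuantumFieldTheory.Balaban1983to89.B4Lemma22Invertible (opA_isUnit_det greenA_mul_opA)
open Literature.MathematicalPhysics.QuantumFieldTheory.Balaban1983to89.B4Lemma22LpStair (lpS lpS_nonneg lpM lpM_nonneg lpM_neg lpM_smul)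
open Literature.MathematicalPhysics.QuantumFieldTheory.Balaban1983to89.B4Lemma22EtaBox (vol vol_pos one_le_vol lpW lpW_nonneg)
open Literature.MathematicalPhysics.QuantumFieldTheory.Balaban1983to89.B4PartitionUnity22 (hprof thetaProf hCube thetaCube D1 D2
  D1_nonneg D2_nonneg contDiff_hprof hasCompactSupport_hprof contDiff_thetaProf hasCompactSupport_thetaProf)
open Literature.MathematicalPhysics.QuantumFieldTheory.Balaban1983to89.B4Eq220PartitionSizes (hZ hBox hsize_hBox)
open Literature.MathematicalPhysics.QuantumFieldTheory.Balaban1983to89.B4CubeFields22 (thetaZ cubeField cubeFluct cubeField_step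
  cubeField_antisymm)
open Literature.MathematicalPhysics.QuantumFieldTheory.Balaban1983to89.B4CubeFieldHyps22 (cubeField_hyps cubeField_threshold
  aSeq_window kOp_smul greenA_smul smul_cubeField)
open Literature.MathematicalPhysics.QuantumFieldTheory.Balaban1983to89.B4Eq220CommutatorField (kOp kOp_eq_opA supN_mulH_le)
open Literature.MathematicalPhysics.QuantumFieldTheory.Balaban1983to89.B4Eq220FactorField (eq220_sup_box eq221_pq_box eq221_psup_box)
open Literature.MathematicalPhysics.QuantumFieldTheory.Balaban1983to89.B4Lemma22CrossSup (lemma22_17_sup_box)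

variable {P : HiggsLattice.Params} {N : ℕ}

/-! ## §1 The `η`-weighted `L^p` norms of the torus and their transport along the cube chart -/

section Norms

variable (K : ℕ) {K₀ : ℕ}

/-- **THE `η`-WEIGHTED MIXED `L^p` NORM OF A FIELD ON `T_ε`**: `‖ψ‖_{p,η} = (η^d Σ_{x ∈ T_ε} |ψ(x)|^p)^{1/p}`, `η^d = L^{−Kd}` the
`η`-volume of a site of `T_ε` viewed from the `L^{−K}`-lattice (`|ψ(x)|` the Euclidean norm over the `N` colours) — the norms
«‖·‖_p» of (2.17)/(2.21) for the torus, r01's `lpW` along the cube chart. [cite: Balaban1983RegularityDecay, (2.17) p.578, (2.21) p.578] -/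
def lpT (p : ℝ) (ψ : HiggsLattice.ScalarField P 0 N) : ℝ :=
  (vol (dd P) (P.L - 1) K)⁻¹ ^ p⁻¹ * lpS p (fun x : HiggsLattice.Site P 0 => ‖ψ x‖)

variable {K}

/-- Unfolding of `lpT`. [cite: Balaban1983RegularityDecay, (2.17) p.578] -/
theorem lpT_def (p : ℝ) (ψ : HiggsLattice.ScalarField P 0 N) :
    lpT K p ψ = (vol (dd P) (P.L - 1) K)⁻¹ ^ p⁻¹ * lpS p (fun x : HiggsLattice.Site P 0 => ‖ψ x‖) := rfl

/-- `‖ψ‖_{p,η} ≥ 0`. [cite: Balaban1983RegularityDecay, (2.17) p.578] -/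
theorem lpT_nonneg (p : ℝ) (ψ : HiggsLattice.ScalarField P 0 N) : 0 ≤ lpT K p ψ :=
  mul_nonneg (Real.rpow_nonneg (inv_nonneg.2 (vol_pos _ _ _).le) _) (lpS_nonneg _ _)

/-- **THE CHART IS A BIJECTION `Box → □_j`**: a sum over the box of a function of `toT z` is the sum over the cube.
[cite: Balaban1983RegularityDecay, §2 p.575] -/
theorem sum_box_eq_sum_cube (hK : K ≤ P.K) (hK₀ : K₀ ∣ P.M) (hK₀' : 1 ≤ K₀) (j : Lab P K K₀) (g : HiggsLattice.Site P 0 → ℝ) :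
    ∑ z : ↥(Box (dd P) (P.L - 1) K (M2 P K₀)), g (toT K K₀ j z.1) = ∑ x ∈ cube K K₀ j, g x := by
  classical
  have hinj : Function.Injective (fun z : ↥(Box (dd P) (P.L - 1) K (M2 P K₀)) => toT K K₀ j z.1) := by
    intro z z' h
    apply Subtype.ext
    have h' := congrArg (fromT K K₀ j) h
    simp only at h'
    rwa [fromT_toT_of_mem hK hK₀ hK₀' j z.2, fromT_toT_of_mem hK hK₀ hK₀' j z'.2] at h'
  have himg : (Finset.univ : Finset ↥(Box (dd P) (P.L - 1) K (M2 P K₀))).image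
      (fun z : ↥(Box (dd P) (P.L - 1) K (M2 P K₀)) => toT K K₀ j z.1) = cube K K₀ j := by
    ext x
    simp only [Finset.mem_image, Finset.mem_univ, true_and]
    constructor
    · rintro ⟨z, rfl⟩
      exact toT_mem_cube hK hK₀ hK₀' j z.2
    · intro hx
      exact ⟨⟨fromT K K₀ j x, (mem_cube_iff hK hK₀ hK₀' j x).1 hx⟩, toT_fromT j x⟩
  rw [← himg, Finset.sum_image (fun z _ z' _ h => hinj h)]

/-- `lpM` of a pulled-back field, as a torus sum over the cube. [cite: Balaban1983RegularityDecay, (2.17) p.578] -/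
theorem lpM_pull_eq_cube (hK : K ≤ P.K) (hK₀ : K₀ ∣ P.M) (hK₀' : 1 ≤ K₀) (j : Lab P K K₀) (p : ℝ)
    (ψ : HiggsLattice.ScalarField P 0 N) :
    lpM p (pull K K₀ j ψ) = (∑ x ∈ cube K K₀ j, ‖ψ x‖ ^ p) ^ p⁻¹ := by
  show (∑ z : ↥(Box (dd P) (P.L - 1) K (M2 P K₀)), |siteNorm (fld (pull K K₀ j ψ) z)| ^ p) ^ p⁻¹ = _
  simp_rw [siteNorm_pull, abs_norm]
  rw [sum_box_eq_sum_cube hK hK₀ hK₀' j (fun x => ‖ψ x‖ ^ p)]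

/-- **TRANSPORT, INEQUALITY**: `‖pull ψ‖_p ≤ (Σ_{x ∈ T_ε}‖ψ(x)‖^p)^{1/p}` (`p > 0`). [cite: Balaban1983RegularityDecay, (2.17) p.578] -/
theorem lpM_pull_le (hK : K ≤ P.K) (hK₀ : K₀ ∣ P.M) (hK₀' : 1 ≤ K₀) (j : Lab P K K₀) {p : ℝ} (hp : 0 < p)
    (ψ : HiggsLattice.ScalarField P 0 N) :
    lpM p (pull K K₀ j ψ) ≤ lpS p (fun x : HiggsLattice.Site P 0 => ‖ψ x‖) := by
  rw [lpM_pull_eq_cube hK hK₀ hK₀' j p ψ]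
  show _ ≤ (∑ x : HiggsLattice.Site P 0, |‖ψ x‖| ^ p) ^ p⁻¹
  simp_rw [abs_norm]
  exact Real.rpow_le_rpow (Finset.sum_nonneg fun x _ => Real.rpow_nonneg (norm_nonneg _) _)
    (Finset.sum_le_univ_sum_of_nonneg fun x => Real.rpow_nonneg (norm_nonneg _) _) (inv_nonneg.2 hp.le)

/-- **TRANSPORT, EQUALITY** for a `□_j`-supported field: `‖pull ψ‖_p = (Σ_{x ∈ T_ε}‖ψ(x)‖^p)^{1/p}` (`p > 0`).
[cite: Balaban1983RegularityDecay, (2.17) p.578] -/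
theorem lpM_pull_eq (hK : K ≤ P.K) (hK₀ : K₀ ∣ P.M) (hK₀' : 1 ≤ K₀) (j : Lab P K K₀) {p : ℝ} (hp : 0 < p)
    {ψ : HiggsLattice.ScalarField P 0 N} (hψ : ∀ x, x ∉ cube K K₀ j → ψ x = 0) :
    lpM p (pull K K₀ j ψ) = lpS p (fun x : HiggsLattice.Site P 0 => ‖ψ x‖) := by
  rw [lpM_pull_eq_cube hK hK₀ hK₀' j p ψ]
  show _ = (∑ x : HiggsLattice.Site P 0, |‖ψ x‖| ^ p) ^ p⁻¹
  simp_rw [abs_norm]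
  rw [Finset.sum_subset (Finset.subset_univ (cube K K₀ j)) fun x _ hx => by
    rw [hψ x hx, norm_zero, Real.zero_rpow hp.ne']]

/-- `‖pull ψ‖_{p,η} ≤ ‖ψ‖_{p,η}` (r01's `lpW` on the box vs `lpT` on the torus). [cite: Balaban1983RegularityDecay, (2.21) p.578] -/
theorem lpW_pull_le (hK : K ≤ P.K) (hK₀ : K₀ ∣ P.M) (hK₀' : 1 ≤ K₀) (j : Lab P K K₀) {p : ℝ} (hp : 0 < p)
    (ψ : HiggsLattice.ScalarField P 0 N) :
    lpW (dd P) (P.L - 1) K p (pull K K₀ j ψ) ≤ lpT K p ψ :=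
  mul_le_mul_of_nonneg_left (lpM_pull_le hK hK₀ hK₀' j hp ψ) (Real.rpow_nonneg (inv_nonneg.2 (vol_pos _ _ _).le) _)

/-- `‖pull ψ‖_{p,η} = ‖ψ‖_{p,η}` for a `□_j`-supported field. [cite: Balaban1983RegularityDecay, (2.21) p.578] -/
theorem lpW_pull_eq (hK : K ≤ P.K) (hK₀ : K₀ ∣ P.M) (hK₀' : 1 ≤ K₀) (j : Lab P K K₀) {p : ℝ} (hp : 0 < p)
    {ψ : HiggsLattice.ScalarField P 0 N} (hψ : ∀ x, x ∉ cube K K₀ j → ψ x = 0) :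
    lpW (dd P) (P.L - 1) K p (pull K K₀ j ψ) = lpT K p ψ := by
  unfold lpW lpT
  rw [lpM_pull_eq hK hK₀ hK₀' j hp hψ]

/-- `η`-weights bookkeeping: `vol^{−1/q}·(vol^{1/p−1/q})^{−1} = vol^{−1/p}`. [folklore] -/
private theorem vol_weights (d ℓ k : ℕ) (p q : ℝ) :
    (vol d ℓ k)⁻¹ ^ q⁻¹ * (vol d ℓ k ^ (p⁻¹ - q⁻¹))⁻¹ = (vol d ℓ k)⁻¹ ^ p⁻¹ := by
  have hv : 0 < vol d ℓ k := vol_pos d ℓ k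
  rw [Real.inv_rpow hv.le, Real.inv_rpow hv.le, ← Real.rpow_neg hv.le, ← Real.rpow_neg hv.le, ← Real.rpow_neg hv.le,
    ← Real.rpow_add hv]
  congr 1
  ring

/-- `(vol^{1/p})^{−1} = vol^{−1/p}` in the `lpT` form. [folklore] -/
private theorem vol_weight_psup (d ℓ k : ℕ) (p : ℝ) : (vol d ℓ k ^ p⁻¹)⁻¹ = (vol d ℓ k)⁻¹ ^ p⁻¹ := by
  rw [Real.inv_rpow (vol_pos d ℓ k).le]

end Norms

/-! ## §2 The per-cube inputs of the mixed `L^p` chain at `Ã_j` -/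

section Inputs

variable {K K₀ : ℕ}

set_option maxHeartbeats 800000 in
/-- **THE PER-CUBE INPUTS (2.17), (2.20) AND THE GRADED FACTORS (2.21) OF THE `L^p` CHAIN, ON THE TORUS AT `Ã_j`.**
For `L ≥ 2` (`ℓ0 = L − 1 ≥ 1`), a window `a ∈ [amin, aplus]` (`amin > 0`), a mass cap `m²(L^Kε)² ≤ m²₊`, a regularity pair `(c, β)`
with `c ≥ 0`, `β > 0`, and an exponent `p₁ > d`: constants `C_γ, C_β > 0` and per cube size `K₀ ≥ 8` a threshold `e₁ > 0` such that for
`K₀ ∣ M`, `1 ≤ K ≤ K_P`, `3M ≤ |T_ε|_μ`, `m² > 0`, every cube `□_j`, every field `A` whose chart-form components satisfy (1.7)/(2.23)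
on `□_j` at an effective coupling `e_K ≤ e₁`, with `u_j = G_K(□_j, Ã_j)(h_jψ)` and the letter `K_ju_j = (H_jh_j − h_jH_j)u_j`:
(2.17) `‖u_j‖_∞ ≤ C_γ(L^Kε)²‖ψ‖_∞`; (2.20) `‖K_ju_j‖_∞ ≤ (C_β/K₀)‖ψ‖_∞`; (2.21) `‖K_ju_j‖_{q,η} ≤ (C_β/K₀)‖ψ‖_{p,η}` for every
`1 ≤ p ≤ q` with `1/p − 1/q ≤ 1/p₁`, and `‖K_ju_j‖_∞ ≤ (C_β/K₀)‖ψ‖_{p,η}` for `p ≥ p₁` — gen 8's chart dictionary applied to this seat's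
box theorems `eq220_sup_box`, `lemma22_17_sup_box`, `eq221_pq_box`, `eq221_psup_box` with [B4]'s own `h_j` (`hsize_hBox`, sizes `s/K₀`,
`s/K₀²`, `s/K₀`), ONE smallness threshold for all four.
[cite: Balaban1983RegularityDecay, Lemma 2.2 (2.17) p.578, (2.20)–(2.21) p.578] [cite: Balaban1982Higgs1, Prop. 2.1 (2.23) p.610] -/
theorem cube_inputs_lp (C : ChargeData N) (d0 ℓ0 : ℕ) (hℓ0 : 1 ≤ ℓ0) (amin aplus m2plus : ℝ) (ha : 0 < amin)
    {p₁ : ℝ} (hp₁ : (d0 : ℝ) + 1 < p₁) :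
    ∃ Cγ Cβ : ℝ, 0 < Cγ ∧ 0 < Cβ ∧ ∀ (creg β : ℝ), 0 ≤ creg → 0 < β → ∀ (K₀ : ℕ), 8 ≤ K₀ →
      ∃ e₁ : ℝ, 0 < e₁ ∧ ∀ (P : HiggsLattice.Params), dd P = d0 → P.L - 1 = ℓ0 →
        ∀ (K : ℕ), 1 ≤ K → K ≤ P.K → K₀ ∣ P.M → (∀ μ, 3 * half P K K₀ ≤ P.sitesPerDir 0 μ) →
        ∀ (a msq : ℝ), amin ≤ a → a ≤ aplus → 0 < msq → msq * P.mesh K ^ 2 ≤ m2plus →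
        ∀ (j : Lab P K K₀) (A : HiggsLattice.VecField P 0) (ec : ℝ), 0 < ec → ec ≤ e₁ →
          (∀ y ∈ Box (dd P) (P.L - 1) K (M2 P K₀), ∀ i i' : Fin (dd P + 1),
            |acT K K₀ j ((((P.L - 1 + 1) ^ K : ℕ) : ℝ) * P.mesh 0 * C.e / ec) A (y + e1 i) i'
              - acT K K₀ j ((((P.L - 1 + 1) ^ K : ℕ) : ℝ) * P.mesh 0 * C.e / ec) A y i'|
              ≤ creg * ec ^ (β - 1) / ((P.L - 1 + 1) ^ K : ℕ)) →
          (∀ ψ : HiggsLattice.ScalarField P 0 N,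
              ‖propagatorK C (cube K K₀ j) (cubeVec K K₀ j A) msq a K (hTor K K₀ j • ψ)‖ ≤ Cγ * P.mesh K ^ 2 * ‖ψ‖) ∧
          (∀ ψ : HiggsLattice.ScalarField P 0 N,
              ‖covOpK C (cube K K₀ j) (cubeVec K K₀ j A) msq a K
                  (hTor K K₀ j • propagatorK C (cube K K₀ j) (cubeVec K K₀ j A) msq a K (hTor K K₀ j • ψ))
                - hTor K K₀ j • covOpK C (cube K K₀ j) (cubeVec K K₀ j A) msq a K
                  (propagatorK C (cube K K₀ j) (cubeVec K K₀ j A) msq a K (hTor K K₀ j • ψ))‖ ≤ Cβ / K₀ * ‖ψ‖) ∧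
          (∀ p q : ℝ, 1 ≤ p → p ≤ q → p⁻¹ - q⁻¹ ≤ p₁⁻¹ → ∀ ψ : HiggsLattice.ScalarField P 0 N,
              lpT K q (covOpK C (cube K K₀ j) (cubeVec K K₀ j A) msq a K
                  (hTor K K₀ j • propagatorK C (cube K K₀ j) (cubeVec K K₀ j A) msq a K (hTor K K₀ j • ψ))
                - hTor K K₀ j • covOpK C (cube K K₀ j) (cubeVec K K₀ j A) msq a K
                  (propagatorK C (cube K K₀ j) (cubeVec K K₀ j A) msq a K (hTor K K₀ j • ψ)))
                ≤ Cβ / K₀ * lpT K p ψ) ∧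
          (∀ p : ℝ, p₁ ≤ p → ∀ ψ : HiggsLattice.ScalarField P 0 N,
              ‖covOpK C (cube K K₀ j) (cubeVec K K₀ j A) msq a K
                  (hTor K K₀ j • propagatorK C (cube K K₀ j) (cubeVec K K₀ j A) msq a K (hTor K K₀ j • ψ))
                - hTor K K₀ j • covOpK C (cube K K₀ j) (cubeVec K K₀ j A) msq a K
                  (propagatorK C (cube K K₀ j) (cubeVec K K₀ j A) msq a K (hTor K K₀ j • ψ))‖
                ≤ Cβ / K₀ * lpT K p ψ) := by
  classical
  -- the constants of Lemma 2.2 / (2.20) / (2.21) at charge 1, generic contour systems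
  obtain ⟨c, hc, hLβ⟩ := eq220_sup_box (flowC C) (ellC_nonneg C) (flowC_lipschitz C) 1 d0 ℓ0 hℓ0 amin aplus m2plus ha
  obtain ⟨c', hc', hLγ⟩ := lemma22_17_sup_box (flowC C) (ellC_nonneg C) (flowC_lipschitz C) 1 d0 ℓ0 hℓ0 amin aplus m2plus ha
  obtain ⟨c₂, hc₂, C₂, hC₂, hLpq⟩ :=
    eq221_pq_box (flowC C) (ellC_nonneg C) (flowC_lipschitz C) 1 d0 ℓ0 hℓ0 amin aplus m2plus ha hp₁
  obtain ⟨c₃, hc₃, C₃, hC₃, hLps⟩ :=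
    eq221_psup_box (flowC C) (ellC_nonneg C) (flowC_lipschitz C) 1 d0 ℓ0 hℓ0 amin aplus m2plus ha hp₁
  by_cases hapl : aplus < amin
  · refine ⟨1, 1, one_pos, one_pos, fun creg β _ _ K₀ _ => ⟨1, one_pos, ?_⟩⟩
    intro P _ _ K _ _ _ _ a msq e1' e2
    exact absurd (e1'.trans e2) (not_le.2 hapl)
  rw [not_lt] at hapl
  have hapl0 : 0 ≤ aplus := ha.le.trans hapl
  have hℓ₁ : 0 ≤ ellC C := ellC_nonneg C
  have hD1 := D1_nonneg contDiff_hprof hasCompactSupport_hprof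
  have hD2 := D2_nonneg contDiff_hprof hasCompactSupport_hprof
  have hp₁0 : 0 < p₁ := by have : (0 : ℝ) ≤ d0 := Nat.cast_nonneg _; linarith
  set D : ℝ := ((d0 : ℝ) + 1) * (D1 hprof + D2 hprof) with hD_def
  have hD : 0 ≤ D := by positivity
  -- `B/K₀` bounds the common prefactor `2(d+1)(1+ℓ₁θ)δ₁ + δ₂ + a_kδ₃`; `W` the largest of the four multipliers
  set B : ℝ := (2 * ((d0 : ℝ) + 1) * (1 + ellC C) + 1 + aplus) * (D + 1) with hB_def
  set W : ℝ := max (2 * (((d0 : ℝ) + 2) * c)) (2 * max C₂ C₃) with hW_def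
  have hB0 : 0 < B := by positivity
  have hW0 : 0 < W := lt_of_lt_of_le (by positivity) (le_max_left _ _)
  set Cβ : ℝ := B * W with hCβ_def
  set Cγ : ℝ := 2 * (((d0 : ℝ) + 2) * c') with hCγ_def
  have hCβ0 : 0 < Cβ := by positivity
  have hCγ0 : 0 < Cγ := by positivity
  refine ⟨Cγ, Cβ, hCγ0, hCβ0, fun creg β hcreg hβ K₀ hK₀8 => ?_⟩
  set cc : ℝ := max (max c c') (max c₂ c₃) with hcc_def
  have hcc : 0 ≤ cc := hc.le.trans ((le_max_left c c').trans (le_max_left _ _))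
  have hc_le : c ≤ cc := (le_max_left c c').trans (le_max_left _ _)
  have hc'_le : c' ≤ cc := (le_max_right c c').trans (le_max_left _ _)
  have hc₂_le : c₂ ≤ cc := (le_max_left c₂ c₃).trans (le_max_right _ _)
  have hc₃_le : c₃ ≤ cc := (le_max_right c₂ c₃).trans (le_max_right _ _)
  obtain ⟨e₁, he₁, hth⟩ := cubeField_threshold d0 (aplus := aplus) hℓ₁ hcc ha hcreg hβ (2 * K₀) K₀
  refine ⟨e₁, he₁, ?_⟩
  intro P hd hl K hK1 hK hK₀ hN3 a msq e1' e2 hmsq e4 j A ec hec hle h17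
  subst hd; subst hl
  -- the instance
  have hK₀' : 1 ≤ K₀ := le_trans (by norm_num) hK₀8
  have hℓ : 1 ≤ P.L - 1 := hℓ0
  have hL2 : 2 ≤ P.L := by omega
  have hn : 1 ≤ (P.L - 1 + 1) ^ K := one_le_n P K
  have hn2 : 2 ≤ (P.L - 1 + 1) ^ K := by
    calc 2 ≤ P.L - 1 + 1 := by omega
      _ = (P.L - 1 + 1) ^ 1 := (pow_one _).symm
      _ ≤ (P.L - 1 + 1) ^ K := Nat.pow_le_pow_right (by omega) hK1
  have hnK : 16 ≤ (P.L - 1 + 1) ^ K * K₀ := by nlinarith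
  have hnK3 : 3 ≤ (P.L - 1 + 1) ^ K * K₀ := le_trans (by norm_num) hnK
  have hnr : (0 : ℝ) < (((P.L - 1 + 1) ^ K : ℕ) : ℝ) := by exact_mod_cast hn
  have hM : ∀ i, 1 ≤ M2 P K₀ i := fun i => by unfold M2; omega
  have hS : ∀ i, M2 P K₀ i ≤ 2 * K₀ := fun i => le_rfl
  have hKM : ∀ μ, K₀ ∣ M2 P K₀ μ := fun μ => ⟨2, by unfold M2; ring⟩
  have hjlo : ∀ μ : Fin (dd P + 1), (1 : ℤ) ≤ (fun _ : Fin (dd P + 1) => (1 : ℤ)) μ := fun μ => le_rfl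
  have hjhi : ∀ μ : Fin (dd P + 1), (K₀ : ℤ) * ((fun _ : Fin (dd P + 1) => (1 : ℤ)) μ + 1) ≤ M2 P K₀ μ := by
    intro μ; unfold M2; push_cast; linarith
  have ha' : 0 < a := lt_of_lt_of_le ha e1'
  have hm2 : 0 ≤ msq * P.mesh K ^ 2 := by positivity
  have hmeshK : 0 < P.mesh K := by unfold HiggsLattice.Params.mesh; have := P.hε; have := P.hL; positivity
  obtain ⟨hak1, hak2⟩ := aSeq_window hℓ hK1 ha e1' e2
  have hak0 : 0 ≤ B1.aSeq a (((P.L - 1 : ℕ) : ℝ) + 1) K := by linarith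
  have hakP : 0 ≤ B1.aSeq a P.L K := aSeq_nonneg_model hL2 ha' hK1
  -- the scaled field and the coupling `κ = e_c/n`, `κσ = εe`
  set σ : ℝ := (((P.L - 1 + 1) ^ K : ℕ) : ℝ) * P.mesh 0 * C.e / ec with hσ
  have hκσ : ec / (((P.L - 1 + 1) ^ K : ℕ) : ℝ) * σ = P.mesh 0 * C.e := by
    rw [hσ]; field_simp
  obtain ⟨hθ1, hsm2, hsm⟩ := hth ec hec hle _ hak1 hak2
  obtain ⟨hanti', hA', hder, hbd⟩ :=
    cubeField_hyps (d := dd P) hn hS hK₀' hnK hjlo hjhi hcreg hec h17 (β := β)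
  -- contour-system facts for the lineage
  have hend' : ∀ y x, blkWt ((P.L - 1 + 1) ^ K) (M2 P K₀) (fun i => (P.L - 1 + 1) ^ K * M2 P K₀ i) y x ≠ 0 →
      pathEnd (baseEmb (one_le_n P K) (M2 P K₀) y) (gammaT P K K₀ y x) = x := fun y x h => gammaT_hend y x h
  have hnn' : ∀ y x, blkWt ((P.L - 1 + 1) ^ K) (M2 P K₀) (fun i => (P.L - 1 + 1) ^ K * M2 P K₀ i) y x ≠ 0 →
      PathRel (fun u v : ↥(Box (dd P) (P.L - 1) K (M2 P K₀)) => v.1 ∈ nbrs u.1)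
        (baseEmb (one_le_n P K) (M2 P K₀) y) (gammaT P K K₀ y x) := fun y x _ => gammaT_nn y x
  -- the quantities θ, θ', τ of the lineage
  set θ : ℝ := ((dd P : ℝ) + 1) * ((2 * K₀ : ℕ) : ℝ) * creg * ec ^ β with hθ_def
  set θ' : ℝ := creg * ec ^ β * (1 + D1 thetaProf * (((dd P : ℝ) + 1) * ((2 * K₀ : ℕ) : ℝ)) / K₀) with hθ'_def
  have hθ0 : 0 ≤ θ := by have := (Real.rpow_pos_of_pos hec β).le; positivity
  have hθ'0 : 0 ≤ θ' := by
    have := (Real.rpow_pos_of_pos hec β).le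
    have := D1_nonneg contDiff_thetaProf hasCompactSupport_thetaProf
    positivity
  set A₀' : Fin (dd P + 1) → ℝ := fun μ => ec / (((P.L - 1 + 1) ^ K : ℕ) : ℝ) * acT K K₀ j σ A 0 μ with hA₀'
  set A' : ↥(Box (dd P) (P.L - 1) K (M2 P K₀)) → ↥(Box (dd P) (P.L - 1) K (M2 P K₀)) → ℝ := fun u v =>
    ec / (((P.L - 1 + 1) ^ K : ℕ) : ℝ) * cubeFluct (Box (dd P) (P.L - 1) K (M2 P K₀)) ((P.L - 1 + 1) ^ K) K₀ (fun _ => 1)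
      (acT K K₀ j σ A 0) (acT K K₀ j σ A) u v with hA'_def
  have hfield : (fun u v => ec / (((P.L - 1 + 1) ^ K : ℕ) : ℝ) * boxField K K₀ j σ A u v)
      = constBond A₀' Subtype.val + A' :=
    smul_cubeField _ _ _ _ _ _
  have hunit : IsUnit (opA (dd P) (flowC C) 1 (P.L - 1) K a (msq * P.mesh K ^ 2) (M2 P K₀)
      (baseEmb (one_le_n P K) (M2 P K₀)) (gammaT P K K₀) (constBond A₀' Subtype.val + A')).det :=
    opA_isUnit_det (flowC C) 1 hℓ hK1 ha' hm2 (M2 P K₀) hnn' hend' _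
  have hτ : ∀ y x, blkWt ((P.L - 1 + 1) ^ K) (M2 P K₀) (fun i => (P.L - 1 + 1) ^ K * M2 P K₀ i) y x ≠ 0 →
      |1 * lsum A' (baseEmb (one_le_n P K) (M2 P K₀) y) (gammaT P K K₀ y x)| ≤ ((dd P : ℝ) + 1) * θ := by
    intro y x _
    have h1 := abs_lsum_le (r := fun u v : ↥(Box (dd P) (P.L - 1) K (M2 P K₀)) => v.1 ∈ nbrs u.1) (κ := 1) (B := A')
      (ρ := θ / ((P.L - 1 + 1) ^ K : ℕ)) (fun u v huv => hA' u v huv) _ _ (gammaT_nn y x)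
    have hlen := length_gammaT_le y x
    have hlenR : ((gammaT P K K₀ y x).length : ℝ) ≤ ((dd P : ℝ) + 1) * ((((P.L - 1 + 1) ^ K : ℕ) : ℝ) - 1) := by
      rw [predL_succ]
      have : (((gammaT P K K₀ y x).length : ℤ) : ℝ) ≤ ((((dd P : ℤ) + 1) * ((P.L : ℤ) ^ K - 1) : ℤ) : ℝ) := by
        exact_mod_cast hlen
      push_cast at this ⊢
      exact this
    refine h1.trans ?_
    rw [div_eq_mul_inv]
    have hθn : 0 ≤ θ * ((((P.L - 1 + 1) ^ K : ℕ) : ℝ))⁻¹ := by positivity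
    calc ((gammaT P K K₀ y x).length : ℝ) * (θ * ((((P.L - 1 + 1) ^ K : ℕ) : ℝ))⁻¹)
        ≤ ((dd P : ℝ) + 1) * ((((P.L - 1 + 1) ^ K : ℕ) : ℝ) - 1) * (θ * ((((P.L - 1 + 1) ^ K : ℕ) : ℝ))⁻¹) :=
          mul_le_mul_of_nonneg_right hlenR hθn
      _ = ((dd P : ℝ) + 1) * θ * (((((P.L - 1 + 1) ^ K : ℕ) : ℝ) - 1) * ((((P.L - 1 + 1) ^ K : ℕ) : ℝ))⁻¹) := by ring
      _ ≤ ((dd P : ℝ) + 1) * θ * 1 := by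
          refine mul_le_mul_of_nonneg_left ?_ (by positivity)
          rw [← div_eq_mul_inv, div_le_one hnr]; linarith
      _ = ((dd P : ℝ) + 1) * θ := mul_one _
  have hτ0 : 0 ≤ ((dd P : ℝ) + 1) * θ := by positivity
  -- the four smallness conditions from the common threshold at `cc = max (max c c') (max c₂ c₃)`
  have hX : 0 ≤ ((dd P : ℝ) + 1) * ellC C * (θ + θ') + ((dd P : ℝ) + 1) * ellC C * θ
      + ((dd P : ℝ) + 1) * ellC C ^ 2 * θ ^ 2
      + B1.aSeq a (((P.L - 1 : ℕ) : ℝ) + 1) K * (ellC C * (((dd P : ℝ) + 1) * θ) * (2 + ellC C * (((dd P : ℝ) + 1) * θ))) := by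
    positivity
  have hsm_of : ∀ c₀ : ℝ, c₀ ≤ cc →
      ((dd P : ℝ) + 2) * c₀ * (((dd P : ℝ) + 1) * ellC C * (θ + θ') + ((dd P : ℝ) + 1) * ellC C * θ
        + ((dd P : ℝ) + 1) * ellC C ^ 2 * θ ^ 2
        + B1.aSeq a (((P.L - 1 : ℕ) : ℝ) + 1) K * (ellC C * (((dd P : ℝ) + 1) * θ) * (2 + ellC C * (((dd P : ℝ) + 1) * θ))))
        ≤ 1 / 2 := by
    intro c₀ hc₀
    refine le_trans ?_ hsm
    exact mul_le_mul_of_nonneg_right (mul_le_mul_of_nonneg_left hc₀ (by positivity)) hX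
  have hsmβ := hsm_of c hc_le
  have hsmγ := hsm_of c' hc'_le
  have hsm₂ := hsm_of c₂ hc₂_le
  have hsm₃ := hsm_of c₃ hc₃_le
  have hHS := hsize_hBox (d := dd P) hn hK₀' hnK3 hKM (fun _ : Fin (dd P + 1) => (1 : ℤ))
  -- the conversion `κ = e_c/n ↦ κ = 1`
  have hconvG : greenA (dd P) (flowC C) (ec / (((P.L - 1 + 1) ^ K : ℕ) : ℝ)) (P.L - 1) K a (msq * P.mesh K ^ 2) (M2 P K₀)
      (baseEmb (one_le_n P K) (M2 P K₀)) (gammaT P K K₀) (boxField K K₀ j σ A)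
      = greenA (dd P) (flowC C) 1 (P.L - 1) K a (msq * P.mesh K ^ 2) (M2 P K₀)
        (baseEmb (one_le_n P K) (M2 P K₀)) (gammaT P K K₀) (constBond A₀' Subtype.val + A') := by
    rw [greenA_smul, hfield]
  have hconvK : kOp (flowC C) (ec / (((P.L - 1 + 1) ^ K : ℕ) : ℝ)) ((P.L - 1 + 1) ^ K)
      (B1.aSeq a (((P.L - 1 : ℕ) : ℝ) + 1) K) (msq * P.mesh K ^ 2) (M2 P K₀) (baseEmb (one_le_n P K) (M2 P K₀))
      (gammaT P K K₀) (boxField K K₀ j σ A) (hBox ((P.L - 1 + 1) ^ K) K₀ (M2 P K₀) (fun _ => 1))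
      = kOp (flowC C) 1 ((P.L - 1 + 1) ^ K) (B1.aSeq a (((P.L - 1 : ℕ) : ℝ) + 1) K) (msq * P.mesh K ^ 2) (M2 P K₀)
        (baseEmb (one_le_n P K) (M2 P K₀)) (gammaT P K K₀) (constBond A₀' Subtype.val + A')
        (hBox ((P.L - 1 + 1) ^ K) K₀ (M2 P K₀) (fun _ => 1)) := by
    rw [kOp_smul, hfield]
  -- supports
  have hGsupp : ∀ φ : HiggsLattice.ScalarField P 0 N, ∀ x, x ∉ cube K K₀ j →
      propagatorK C (cube K K₀ j) (cubeVec K K₀ j A) msq a K (hTor K K₀ j • φ) x = 0 := fun φ x hx =>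
    propagatorK_cube_supported C hK hK₀ hK₀' hN3 j _ hmsq a hakP (fun x' hx' => hTor_smul_eq_zero_off hK hK₀ hK₀8 j φ hx') hx
  have hvsupp : ∀ ψ : HiggsLattice.ScalarField P 0 N, ∀ x, x ∉ cube K K₀ j →
      (covOpK C (cube K K₀ j) (cubeVec K K₀ j A) msq a K
          (hTor K K₀ j • propagatorK C (cube K K₀ j) (cubeVec K K₀ j A) msq a K (hTor K K₀ j • ψ))
        - hTor K K₀ j • covOpK C (cube K K₀ j) (cubeVec K K₀ j A) msq a K
          (propagatorK C (cube K K₀ j) (cubeVec K K₀ j A) msq a K (hTor K K₀ j • ψ))) x = 0 := by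
    intro ψ x hx
    rw [Pi.sub_apply, covOpK_cube_apply_eq_zero_of_in C hK hK₀ hK₀' hN3 j _ msq a
      (fun x' hx' => hTor_smul_eq_zero_off hK hK₀ hK₀8 j _ hx') hx, hTor_smul_eq_zero_off hK hK₀ hK₀8 j _ hx, sub_zero]
  -- THE CHART DICTIONARY FOR THE LETTER: `pull(K_ju_j) = −K·G·h·pull ψ` at charge `1`
  have hletter : ∀ ψ : HiggsLattice.ScalarField P 0 N,
      pull K K₀ j (covOpK C (cube K K₀ j) (cubeVec K K₀ j A) msq a K
          (hTor K K₀ j • propagatorK C (cube K K₀ j) (cubeVec K K₀ j A) msq a K (hTor K K₀ j • ψ))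
        - hTor K K₀ j • covOpK C (cube K K₀ j) (cubeVec K K₀ j A) msq a K
          (propagatorK C (cube K K₀ j) (cubeVec K K₀ j A) msq a K (hTor K K₀ j • ψ)))
      = -(kOp (flowC C) 1 ((P.L - 1 + 1) ^ K) (B1.aSeq a (((P.L - 1 : ℕ) : ℝ) + 1) K) (msq * P.mesh K ^ 2) (M2 P K₀)
            (baseEmb (one_le_n P K) (M2 P K₀)) (gammaT P K K₀) (constBond A₀' Subtype.val + A')
            (hBox ((P.L - 1 + 1) ^ K) K₀ (M2 P K₀) (fun _ => 1))
          *ᵥ (greenA (dd P) (flowC C) 1 (P.L - 1) K a (msq * P.mesh K ^ 2) (M2 P K₀)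
            (baseEmb (one_le_n P K) (M2 P K₀)) (gammaT P K K₀) (constBond A₀' Subtype.val + A')
            *ᵥ (mulH (hBox ((P.L - 1 + 1) ^ K) K₀ (M2 P K₀) (fun _ => 1)) *ᵥ pull K K₀ j ψ))) := by
    intro ψ
    have hs0 : P.mesh K ^ 2 ≠ 0 := by positivity
    rw [pull_commutator C hK hK₀ hK₀8 hN3 j hκσ a msq A, pull_propagatorK C hK hK1 hK₀ hK₀8 hN3 hL2 j hκσ ha' hmsq A,
      pull_hsmul_hTor hK hK₀ hK₀' j ψ, Matrix.mulVec_smul, smul_smul, inv_mul_cancel₀ hs0, one_smul, hconvK, hconvG]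
  -- the prefactor bound `2(d+1)(1+ℓ₁θ)δ₁ + δ₂ + a_kδ₃ ≤ B/K₀` (`δ₁ = δ₃ = D/K₀`, `δ₂ = D/K₀²`)
  have hKr : (1 : ℝ) ≤ K₀ := by exact_mod_cast hK₀'
  have hKpos : (0 : ℝ) < K₀ := by linarith
  have hpref : 2 * ((dd P : ℝ) + 1) * (1 + ellC C * θ) * (((dd P : ℝ) + 1) * (D1 hprof + D2 hprof) / K₀)
        + ((dd P : ℝ) + 1) * (D1 hprof + D2 hprof) / (K₀ : ℝ) ^ 2
        + B1.aSeq a (((P.L - 1 : ℕ) : ℝ) + 1) K * (((dd P : ℝ) + 1) * (D1 hprof + D2 hprof) / K₀) ≤ B / K₀ := by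
    rw [hB_def, ← hD_def]
    have h1 : ellC C * θ ≤ ellC C := mul_le_of_le_one_right hℓ₁ hθ1
    have hKsq : (K₀ : ℝ) ≤ (K₀ : ℝ) ^ 2 := by rw [sq]; exact le_mul_of_one_le_left hKpos.le hKr
    have h2 : D / (K₀ : ℝ) ^ 2 ≤ D / K₀ := div_le_div_of_nonneg_left hD hKpos hKsq
    have h3 : B1.aSeq a (((P.L - 1 : ℕ) : ℝ) + 1) K * (D / K₀) ≤ aplus * (D / K₀) :=
      mul_le_mul_of_nonneg_right hak2 (by positivity)
    have h4 : 2 * ((dd P : ℝ) + 1) * (1 + ellC C * θ) * (D / K₀) ≤ 2 * ((dd P : ℝ) + 1) * (1 + ellC C) * (D / K₀) :=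
      mul_le_mul_of_nonneg_right (mul_le_mul_of_nonneg_left ((add_le_add_iff_left 1).2 h1) (by positivity)) (by positivity)
    have h5 : (2 * ((dd P : ℝ) + 1) * (1 + ellC C) + 1 + aplus) * (D / K₀)
        ≤ (2 * ((dd P : ℝ) + 1) * (1 + ellC C) + 1 + aplus) * ((D + 1) / K₀) :=
      mul_le_mul_of_nonneg_left (div_le_div_of_nonneg_right (by linarith) hKpos.le) (by positivity)
    calc 2 * ((dd P : ℝ) + 1) * (1 + ellC C * θ) * (D / K₀) + D / (K₀ : ℝ) ^ 2
          + B1.aSeq a (((P.L - 1 : ℕ) : ℝ) + 1) K * (D / K₀)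
        ≤ 2 * ((dd P : ℝ) + 1) * (1 + ellC C) * (D / K₀) + D / K₀ + aplus * (D / K₀) := add_le_add (add_le_add h4 h2) h3
      _ = (2 * ((dd P : ℝ) + 1) * (1 + ellC C) + 1 + aplus) * (D / K₀) := by ring
      _ ≤ _ := h5
      _ = (2 * ((dd P : ℝ) + 1) * (1 + ellC C) + 1 + aplus) * (D + 1) / K₀ := by ring
  have hpref0 : 0 ≤ 2 * ((dd P : ℝ) + 1) * (1 + ellC C * θ) * (((dd P : ℝ) + 1) * (D1 hprof + D2 hprof) / K₀)
        + ((dd P : ℝ) + 1) * (D1 hprof + D2 hprof) / (K₀ : ℝ) ^ 2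
        + B1.aSeq a (((P.L - 1 : ℕ) : ℝ) + 1) K * (((dd P : ℝ) + 1) * (D1 hprof + D2 hprof) / K₀) := by positivity
  -- each multiplier is `≤ W`, so prefactor·multiplier ≤ Cβ/K₀
  have hmult : ∀ {m : ℝ}, 0 ≤ m → m ≤ W →
      (2 * ((dd P : ℝ) + 1) * (1 + ellC C * θ) * (((dd P : ℝ) + 1) * (D1 hprof + D2 hprof) / K₀)
        + ((dd P : ℝ) + 1) * (D1 hprof + D2 hprof) / (K₀ : ℝ) ^ 2
        + B1.aSeq a (((P.L - 1 : ℕ) : ℝ) + 1) K * (((dd P : ℝ) + 1) * (D1 hprof + D2 hprof) / K₀)) * m ≤ Cβ / K₀ := by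
    intro m hm0 hmW
    rw [hCβ_def]
    calc _ ≤ B / K₀ * W := mul_le_mul hpref hmW hm0 (by positivity)
      _ = B * W / K₀ := by ring
  have hvol : 0 < vol (dd P) (P.L - 1) K := vol_pos _ _ _
  have hvol1 : 1 ≤ vol (dd P) (P.L - 1) K := one_le_vol _ _ _
  refine ⟨?_, ?_, ?_, ?_⟩
  · -- (2.17): `‖G_j(h_jψ)‖ ≤ Cγ(L^Kε)²‖ψ‖`
    intro ψ
    have main := (hLγ K hK1 a _ e1' e2 hm2 e4 (M2 P K₀) hM (baseEmb (one_le_n P K) (M2 P K₀)) (gammaT P K K₀) hend'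
      A₀' A' θ θ' (((dd P : ℝ) + 1) * θ) hunit hθ0 hA' hθ'0 hder hbd hτ0 hτ hsmγ
      (mulH (hBox ((P.L - 1 + 1) ^ K) K₀ (M2 P K₀) (fun _ => 1)) *ᵥ pull K K₀ j ψ)).1
    have hsum : 0 ≤ ∑ μ, supN (B4Lemma22ReduceZero.derivA0 (dd P) (flowC C) 1 (P.L - 1) K (M2 P K₀) A₀' μ
        *ᵥ (greenA (dd P) (flowC C) 1 (P.L - 1) K a (msq * P.mesh K ^ 2) (M2 P K₀)
          (baseEmb (one_le_n P K) (M2 P K₀)) (gammaT P K K₀) (constBond A₀' Subtype.val + A')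
            *ᵥ (mulH (hBox ((P.L - 1 + 1) ^ K) K₀ (M2 P K₀) (fun _ => 1)) *ᵥ pull K K₀ j ψ))) :=
      Finset.sum_nonneg fun μ _ => supN_nonneg _
    have hG : supN (greenA (dd P) (flowC C) 1 (P.L - 1) K a (msq * P.mesh K ^ 2) (M2 P K₀)
        (baseEmb (one_le_n P K) (M2 P K₀)) (gammaT P K K₀) (constBond A₀' Subtype.val + A')
          *ᵥ (mulH (hBox ((P.L - 1 + 1) ^ K) K₀ (M2 P K₀) (fun _ => 1)) *ᵥ pull K K₀ j ψ))
        ≤ Cγ * supN (mulH (hBox ((P.L - 1 + 1) ^ K) K₀ (M2 P K₀) (fun _ => 1)) *ᵥ pull K K₀ j ψ) := by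
      rw [hCγ_def]; linarith
    rw [norm_eq_supN_pull hK hK₀ hK₀' j (hGsupp ψ), pull_propagatorK C hK hK1 hK₀ hK₀8 hN3 hL2 j hκσ ha' hmsq A,
      pull_hsmul_hTor hK hK₀ hK₀' j ψ, hconvG]
    calc supN (P.mesh K ^ 2 • (greenA (dd P) (flowC C) 1 (P.L - 1) K a (msq * P.mesh K ^ 2) (M2 P K₀)
          (baseEmb (one_le_n P K) (M2 P K₀)) (gammaT P K K₀) (constBond A₀' Subtype.val + A')
            *ᵥ (mulH (hBox ((P.L - 1 + 1) ^ K) K₀ (M2 P K₀) (fun _ => 1)) *ᵥ pull K K₀ j ψ)))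
        ≤ |P.mesh K ^ 2| * supN (greenA (dd P) (flowC C) 1 (P.L - 1) K a (msq * P.mesh K ^ 2) (M2 P K₀)
          (baseEmb (one_le_n P K) (M2 P K₀)) (gammaT P K K₀) (constBond A₀' Subtype.val + A')
            *ᵥ (mulH (hBox ((P.L - 1 + 1) ^ K) K₀ (M2 P K₀) (fun _ => 1)) *ᵥ pull K K₀ j ψ)) := supN_smul_le _ _
      _ ≤ |P.mesh K ^ 2| * (Cγ * supN (pull K K₀ j ψ)) := by
          refine mul_le_mul_of_nonneg_left (hG.trans ?_) (abs_nonneg _)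
          exact mul_le_mul_of_nonneg_left (supN_mulH_le hHS.abs_le _) hCγ0.le
      _ ≤ |P.mesh K ^ 2| * (Cγ * ‖ψ‖) :=
          mul_le_mul_of_nonneg_left (mul_le_mul_of_nonneg_left (supN_pull_le j ψ) hCγ0.le) (abs_nonneg _)
      _ = Cγ * P.mesh K ^ 2 * ‖ψ‖ := by rw [abs_of_nonneg (by positivity)]; ring
  · -- (2.20): `‖K_jG_j(h_jψ)‖ ≤ (Cβ/K₀)‖ψ‖`
    intro ψ
    have main := hLβ K hK1 a _ e1' e2 hm2 e4 (M2 P K₀) hM (baseEmb (one_le_n P K) (M2 P K₀)) (gammaT P K K₀) hend'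
      A₀' A' θ θ' (((dd P : ℝ) + 1) * θ) hanti' hunit hθ0 hA' hθ'0 hder hbd hτ0 hτ hsmβ _ _ _
      (hBox ((P.L - 1 + 1) ^ K) K₀ (M2 P K₀) (fun _ => 1)) hHS (pull K K₀ j ψ)
    rw [norm_eq_supN_pull hK hK₀ hK₀' j (hvsupp ψ), hletter ψ, supN_neg]
    refine main.trans ?_
    have hψ0 := supN_nonneg (pull K K₀ j ψ)
    have hmW : 2 * (((dd P : ℝ) + 2) * c) ≤ W := le_max_left _ _
    calc _ ≤ Cβ / K₀ * supN (pull K K₀ j ψ) := mul_le_mul_of_nonneg_right (hmult (by positivity) hmW) hψ0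
      _ ≤ Cβ / K₀ * ‖ψ‖ := mul_le_mul_of_nonneg_left (supN_pull_le j ψ) (by positivity)
  · -- (2.21), graded pairs: `‖K_jG_j(h_jψ)‖_{q,η} ≤ (Cβ/K₀)‖ψ‖_{p,η}`
    intro p q hp hpq hσpq ψ
    have hp0 : 0 < p := by linarith
    have hq0 : 0 < q := by linarith
    have main := hLpq K hK1 a _ e1' e2 hm2 e4 (M2 P K₀) hM (baseEmb (one_le_n P K) (M2 P K₀)) (gammaT P K K₀) hend'
      A₀' A' θ θ' (((dd P : ℝ) + 1) * θ) hanti' hunit hθ0 hA' hθ'0 hder hbd hτ0 hτ hsm₂ p q hp hpq hσpq _ _ _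
      (hBox ((P.L - 1 + 1) ^ K) K₀ (M2 P K₀) (fun _ => 1)) hHS (pull K K₀ j ψ)
    rw [← lpW_pull_eq hK hK₀ hK₀' j hq0 (hvsupp ψ), lpW, hletter ψ, lpM_neg]
    have hvq : 0 ≤ (vol (dd P) (P.L - 1) K)⁻¹ ^ q⁻¹ := Real.rpow_nonneg (inv_nonneg.2 hvol.le) _
    have hψ0 := lpM_nonneg p (pull K K₀ j ψ)
    -- the multiplier `2C₂·vol^{−(1/p−1/q)}`; after the `η`-weights `vol^{−1/q}·vol^{−(1/p−1/q)} = vol^{−1/p}`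
    have hmW : 2 * C₂ ≤ W := (mul_le_mul_of_nonneg_left (le_max_left C₂ C₃) zero_le_two).trans (le_max_right _ _)
    have hvf : 0 ≤ (vol (dd P) (P.L - 1) K ^ (p⁻¹ - q⁻¹))⁻¹ := inv_nonneg.2 (Real.rpow_nonneg hvol.le _)
    calc (vol (dd P) (P.L - 1) K)⁻¹ ^ q⁻¹ * lpM q (kOp (flowC C) 1 ((P.L - 1 + 1) ^ K)
            (B1.aSeq a (((P.L - 1 : ℕ) : ℝ) + 1) K) (msq * P.mesh K ^ 2) (M2 P K₀) (baseEmb (one_le_n P K) (M2 P K₀))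
            (gammaT P K K₀) (constBond A₀' Subtype.val + A') (hBox ((P.L - 1 + 1) ^ K) K₀ (M2 P K₀) (fun _ => 1))
          *ᵥ (greenA (dd P) (flowC C) 1 (P.L - 1) K a (msq * P.mesh K ^ 2) (M2 P K₀)
            (baseEmb (one_le_n P K) (M2 P K₀)) (gammaT P K K₀) (constBond A₀' Subtype.val + A')
            *ᵥ (mulH (hBox ((P.L - 1 + 1) ^ K) K₀ (M2 P K₀) (fun _ => 1)) *ᵥ pull K K₀ j ψ)))
        ≤ (vol (dd P) (P.L - 1) K)⁻¹ ^ q⁻¹ *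
          ((2 * ((dd P : ℝ) + 1) * (1 + ellC C * θ) * (((dd P : ℝ) + 1) * (D1 hprof + D2 hprof) / K₀)
            + ((dd P : ℝ) + 1) * (D1 hprof + D2 hprof) / (K₀ : ℝ) ^ 2
            + B1.aSeq a (((P.L - 1 : ℕ) : ℝ) + 1) K * (((dd P : ℝ) + 1) * (D1 hprof + D2 hprof) / K₀))
            * (2 * (C₂ * (vol (dd P) (P.L - 1) K ^ (p⁻¹ - q⁻¹))⁻¹)) * lpM p (pull K K₀ j ψ)) :=
          mul_le_mul_of_nonneg_left main hvq
      _ = ((2 * ((dd P : ℝ) + 1) * (1 + ellC C * θ) * (((dd P : ℝ) + 1) * (D1 hprof + D2 hprof) / K₀)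
            + ((dd P : ℝ) + 1) * (D1 hprof + D2 hprof) / (K₀ : ℝ) ^ 2
            + B1.aSeq a (((P.L - 1 : ℕ) : ℝ) + 1) K * (((dd P : ℝ) + 1) * (D1 hprof + D2 hprof) / K₀)) * (2 * C₂))
          * (((vol (dd P) (P.L - 1) K)⁻¹ ^ q⁻¹ * (vol (dd P) (P.L - 1) K ^ (p⁻¹ - q⁻¹))⁻¹) * lpM p (pull K K₀ j ψ)) := by
          ring
      _ = ((2 * ((dd P : ℝ) + 1) * (1 + ellC C * θ) * (((dd P : ℝ) + 1) * (D1 hprof + D2 hprof) / K₀)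
            + ((dd P : ℝ) + 1) * (D1 hprof + D2 hprof) / (K₀ : ℝ) ^ 2
            + B1.aSeq a (((P.L - 1 : ℕ) : ℝ) + 1) K * (((dd P : ℝ) + 1) * (D1 hprof + D2 hprof) / K₀)) * (2 * C₂))
          * lpW (dd P) (P.L - 1) K p (pull K K₀ j ψ) := by
          rw [vol_weights]; rfl
      _ ≤ Cβ / K₀ * lpW (dd P) (P.L - 1) K p (pull K K₀ j ψ) :=
          mul_le_mul_of_nonneg_right (hmult (by positivity) hmW) (lpW_nonneg _ _ _ _ _)
      _ ≤ Cβ / K₀ * lpT K p ψ := mul_le_mul_of_nonneg_left (lpW_pull_le hK hK₀ hK₀' j hp0 ψ) (by positivity)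
  · -- (2.21), the first factor «‖·‖_{∞,p₁}»: `‖K_jG_j(h_jψ)‖_∞ ≤ (Cβ/K₀)‖ψ‖_{p,η}`, `p ≥ p₁`
    intro p hp ψ
    have hp0 : 0 < p := lt_of_lt_of_le hp₁0 hp
    have main := hLps K hK1 a _ e1' e2 hm2 e4 (M2 P K₀) hM (baseEmb (one_le_n P K) (M2 P K₀)) (gammaT P K K₀) hend'
      A₀' A' θ θ' (((dd P : ℝ) + 1) * θ) hanti' hunit hθ0 hA' hθ'0 hder hbd hτ0 hτ hsm₃ p hp _ _ _
      (hBox ((P.L - 1 + 1) ^ K) K₀ (M2 P K₀) (fun _ => 1)) hHS (pull K K₀ j ψ)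
    rw [norm_eq_supN_pull hK hK₀ hK₀' j (hvsupp ψ), hletter ψ, supN_neg]
    refine main.trans ?_
    have hψ0 := lpM_nonneg p (pull K K₀ j ψ)
    have hmW : 2 * C₃ ≤ W := (mul_le_mul_of_nonneg_left (le_max_right C₂ C₃) zero_le_two).trans (le_max_right _ _)
    have hvf : 0 ≤ (vol (dd P) (P.L - 1) K ^ p⁻¹)⁻¹ := inv_nonneg.2 (Real.rpow_nonneg hvol.le _)
    calc (2 * ((dd P : ℝ) + 1) * (1 + ellC C * θ) * (((dd P : ℝ) + 1) * (D1 hprof + D2 hprof) / K₀)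
            + ((dd P : ℝ) + 1) * (D1 hprof + D2 hprof) / (K₀ : ℝ) ^ 2
            + B1.aSeq a (((P.L - 1 : ℕ) : ℝ) + 1) K * (((dd P : ℝ) + 1) * (D1 hprof + D2 hprof) / K₀))
          * (2 * (C₃ * (vol (dd P) (P.L - 1) K ^ p⁻¹)⁻¹)) * lpM p (pull K K₀ j ψ)
        = ((2 * ((dd P : ℝ) + 1) * (1 + ellC C * θ) * (((dd P : ℝ) + 1) * (D1 hprof + D2 hprof) / K₀)
            + ((dd P : ℝ) + 1) * (D1 hprof + D2 hprof) / (K₀ : ℝ) ^ 2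
            + B1.aSeq a (((P.L - 1 : ℕ) : ℝ) + 1) K * (((dd P : ℝ) + 1) * (D1 hprof + D2 hprof) / K₀)) * (2 * C₃))
          * ((vol (dd P) (P.L - 1) K ^ p⁻¹)⁻¹ * lpM p (pull K K₀ j ψ)) := by ring
      _ = ((2 * ((dd P : ℝ) + 1) * (1 + ellC C * θ) * (((dd P : ℝ) + 1) * (D1 hprof + D2 hprof) / K₀)
            + ((dd P : ℝ) + 1) * (D1 hprof + D2 hprof) / (K₀ : ℝ) ^ 2
            + B1.aSeq a (((P.L - 1 : ℕ) : ℝ) + 1) K * (((dd P : ℝ) + 1) * (D1 hprof + D2 hprof) / K₀)) * (2 * C₃))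
          * lpW (dd P) (P.L - 1) K p (pull K K₀ j ψ) := by
          rw [vol_weight_psup]; rfl
      _ ≤ Cβ / K₀ * lpW (dd P) (P.L - 1) K p (pull K K₀ j ψ) :=
          mul_le_mul_of_nonneg_right (hmult (by positivity) hmW) (lpW_nonneg _ _ _ _ _)
      _ ≤ Cβ / K₀ * lpT K p ψ := mul_le_mul_of_nonneg_left (lpW_pull_le hK hK₀ hK₀' j hp0 ψ) (by positivity)

end Inputs

end Literature.MathematicalPhysics.QuantumFieldTheory.Balaban1983to89.B1TorusCubeLpInput

end
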